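import Literature.Barriers.AtomisticToContinuum.TetrahedralFrustrationRogersSector
import Mathlib.Analysis.InnerProductSpace.Projection.Basic
import Mathlib.LinearAlgebra.CrossProduct
import Mathlib.LinearAlgebra.Matrix.DotProduct
import Mathlib.LinearAlgebra.Matrix.ToLinearEquiv
import HarnessLib

/-!
# Rogers's dissection of a Voronoi cell — proved; Rogers's bound `σ₃` discharged

Topic `Literature/Barriers/AtomisticToContinuum`; last file of the provefact programme for the
named fact `Literature.Barriers.AtomisticToContinuum.Rogers1958_bound` of
`TetrahedralFrustration.lean`.  `TetrahedralFrustrationRogers.lean` reduced Rogers's bound to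
the named facts `Rogers1964_orthoschemeSectorVolume` (discharged in
`TetrahedralFrustrationRogersSector.lean`, imported) and `Rogers1964_dissection`; this file
DISCHARGES the latter (`Rogers1964_dissection_holds`) and concludes

`Rogers1958_bound_holds : Rogers1958_bound`

— for every packing `V` of unit balls in `ℝ³`, `limsup_{r → ∞} δ(V, 0, r) ≤ σ₃ = √2 (3 arccos ⅓ − π)
≈ 0.7797` [Rogers1964, Ch. 7, Theorem 7.1; Introduction §3; HalesDSP2012, §6.2].

## The dissection (Rogers 1964, Ch. 7 §2; Hales 2012, Lemmas 6.26 and 6.29), as formalised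

Fix a saturated packing `V`, a centre `v ∈ V` and its cell `Ω = Ω(V, v)` (compact, convex,
`B̄(v,1) ⊆ Ω ⊆ B(v,2)`).  The constraints are the affine SLACK FUNCTIONS
`f_k(p) = dist(p,v)² − dist(p,k)² = 2⟪p − v, k − v⟫ − ‖k − v‖²` (`slackFn`), `≤ 0` on `Ω`; only
the NEAR centres `k ∈ N = (V ∩ B(v,4)) ∖ {v}` (`nearSet`, finite) matter on `B(v,2)`
(`mem_voronoiCell_iff_slackFn`).  Faces are indexed by centres, not by the face lattice:
`F¹ᵢ = Ω ∩ {fᵢ = 0}`, `F²ᵢⱼ = F¹ᵢ ∩ {fⱼ = 0}`, `F³ᵢⱼₖ = F²ᵢⱼ ∩ {f_k = 0}` (`face1/2/3`), and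
Rogers's points are `c₁(i), c₂(i,j), c₃(i,j,k)` = the points of these faces NEAREST TO `v`
(`cpt1/2/3`, via the Hilbert projection theorem, Part B1) — Rogers's "point of the
`(n − j)`-dimensional face nearest to `a`" [Rogers1964, Ch. 7 §2], not Hales's recursive
`ω_{j+1} =` closest point to `ω_j` (Definition 6.24), which does not give Lemma 2.  The simplex of
a GOOD triple (`i, j, k ∈ N` pairwise distinct with `F³ᵢⱼₖ ≠ ∅`) is
`conv{v, c₁(i), c₂(i,j), c₃(i,j,k)} = rogersSimplex v (pieceVec (i,j,k))`.

* Part B7 (`isRogersGram_pieceVec`): **Lemma 2** — with origin `v`, `cₐ · c_b ≥ 2a/(a+1)`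
  (`1, 4/3, 3/2`) for `a ≤ b`: the diagonal terms by the triangle inequality (`a = 1`) and by
  **Blichfeldt's inequality** (Part B2: a point at distance `R` from `m + 1` centres pairwise
  `≥ 2` apart has `R² ≥ 2m/(m+1)`) [Rogers1964, Ch. 7 §3, Lemma 1]; the cross terms by the
  variational inequality of nearest points (`c_b` lies in the face whose nearest point is `cₐ`)
  [Rogers1964, Ch. 7 §3, Lemma 2].
* Part B8 (`pieceVec_subset`): the simplices lie in `Ω` (convexity).
* Part B9 (`cover`): **no gaps** — every `x ∈ Ω` lies in the simplex of a good triple or in one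
  of the finitely many planar (null) triangles `conv{v, c₁(i), c₂(i,j)}`: follow the ray from `v`
  through `x` to its exit point `e₁` (tight for some `i`, so `e₁ ∈ F¹ᵢ`), then the ray from `c₁(i)`
  through `e₁` to `e₂ ∈ F²ᵢⱼ`, then the ray from `c₂(i,j)` through `e₂` to `e₃ ∈ F³ᵢⱼₖ = {e₃}`;
  the **ray-exit lemma** (Part B5, `ray_exit`: at the last point of `Ω` on a ray some near
  constraint is tight and strictly increasing — else one could continue, `Ω ⊆ B(v,2)` being open
  and `N` finite) is Hales's "the ray … meets `P` in an interval `conv{u, w}`, where `w` lies …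
  in a facet" [HalesDSP2012, Lemma 5.56 (proof)], [Rogers1964, Ch. 7 §2].
* Parts B10–B11 (`volume_inter_pieces`): **no overlaps** of positive measure — distinct edge
  triples give simplices meeting in a null set [Rogers1964, Ch. 7 §2: "fit together, without
  overlapping"], [HalesDSP2012, Lemma 6.29]: degenerate simplices (when `c₁(i)` is already tight
  for `j`, or `c₂(i,j)` for `k`) are null by a determinant computation; otherwise a common point
  `p ≠ v` has barycentric normal forms `p = lineMap v y s`, `y = lineMap c₁ z σ`,
  `z = lineMap c₂ c₃ τ`, and the **uniqueness lemma** (`lineMap_unique`: two tight directions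
  from a strictly slack apex determine the point) applied at `v`, at `c₁` and at `c₂`, with the
  **line lemma** (Part B3/B6: points tight for two non-collinear centres differ by multiples of
  the cross product `(i − v) × (j − v)`), leaves only points of planar triangles.
* Part B12: the finite family `s = image pieceVec (good triples)` witnesses
  `Rogers1964_dissection`; with `Rogers1958_bound_of_dissection` this proves `Rogers1958_bound`.

All auxiliary notions live in the sub-namespace `RogersDissection`; the two discharges are in
the topic namespace.

## References

* C. A. Rogers, *Packing and Covering*, Cambridge Tracts 54, CUP 1964 (`Rogers1964`): Ch. 7 §1
  (pp. 74–77), §2 (pp. 77–78: the dissection), §3 Lemma 1 (Blichfeldt) and Lemma 2 (pp. 78–80),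
  §4 Theorem 7.1 (pp. 80–85).
* T. C. Hales, *Dense Sphere Packings*, LMS LNS 400, CUP 2012 (`HalesDSP2012`): Lemma 5.56,
  Definitions 6.24–6.25, Lemma 6.26 (Rogers decomposition), Lemma 6.29 (Rogers disjoint).
* C. A. Rogers, *The packing of equal spheres*, Proc. LMS (3) 8 (1958) 609–620 (`Rogers1958`).
-/

noncomputable section

open Real MeasureTheory Metric Filter Set
open scoped ENNReal RealInnerProductSpace Topology Matrix

namespace Literature.Barriers.AtomisticToContinuum

open Literature.Geometry.DiscreteGeometry (IsUnitBallPacking)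

/-- Euclidean `3`-space. -/
local notation "E3" => EuclideanSpace ℝ (Fin 3)

namespace RogersDissection

/-! ### B1. Nearest points of closed convex sets -/

/-- Existence of the nearest point with its variational inequality. [folklore] -/
theorem exists_nearestPt {K : Set E3} (hK : IsClosed K) (hc : Convex ℝ K) (hne : K.Nonempty)
    (v : E3) : ∃ c ∈ K, ∀ x ∈ K, ⟪v - c, x - c⟫ ≤ 0 := by
  obtain ⟨c, hcK, hc'⟩ := exists_norm_eq_iInf_of_complete_convex hne hK.isComplete hc v
  exact ⟨c, hcK, (norm_eq_iInf_iff_real_inner_le_zero hc hcK).1 hc'⟩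

open Classical in
/-- The nearest point of `K` to `v` (junk value `v` unless `K` has one with the variational
inequality, e.g. `K` closed, convex, nonempty). [folklore] -/
def nearestPt (K : Set E3) (v : E3) : E3 :=
  if h : ∃ c ∈ K, ∀ x ∈ K, ⟪v - c, x - c⟫ ≤ 0 then h.choose else v

/-- The nearest point lies in `K` and satisfies the variational inequality. [folklore] -/
theorem nearestPt_spec {K : Set E3} (hK : IsClosed K) (hc : Convex ℝ K) (hne : K.Nonempty)
    (v : E3) : nearestPt K v ∈ K ∧ ∀ x ∈ K, ⟪v - nearestPt K v, x - nearestPt K v⟫ ≤ 0 := by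
  have h := exists_nearestPt hK hc hne v
  rw [nearestPt, dif_pos h]
  exact h.choose_spec

/-- The nearest point lies in `K`. [folklore] -/
theorem nearestPt_mem {K : Set E3} (hK : IsClosed K) (hc : Convex ℝ K) (hne : K.Nonempty)
    (v : E3) : nearestPt K v ∈ K :=
  (nearestPt_spec hK hc hne v).1

/-- The variational inequality `⟪v − c, x − c⟫ ≤ 0` of the nearest point `c`. [folklore] -/
theorem inner_nearestPt_le {K : Set E3} (hK : IsClosed K) (hc : Convex ℝ K) (hne : K.Nonempty)
    (v : E3) {x : E3} (hx : x ∈ K) : ⟪v - nearestPt K v, x - nearestPt K v⟫ ≤ 0 :=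
  (nearestPt_spec hK hc hne v).2 x hx

/-- The Gram form of the variational inequality: `⟪c − v, x − v⟫ ≥ ‖c − v‖²`. [folklore] -/
theorem norm_sq_le_inner_nearestPt {K : Set E3} (hK : IsClosed K) (hc : Convex ℝ K)
    (hne : K.Nonempty) (v : E3) {x : E3} (hx : x ∈ K) :
    ‖nearestPt K v - v‖ ^ 2 ≤ ⟪nearestPt K v - v, x - v⟫ := by
  have h := inner_nearestPt_le hK hc hne v hx
  set c := nearestPt K v
  have e : x - v = (x - c) + (c - v) := by abel
  rw [e, inner_add_right, real_inner_self_eq_norm_sq]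
  have : ⟪c - v, x - c⟫ = -⟪v - c, x - c⟫ := by
    rw [← inner_neg_left, neg_sub]
  linarith

/-- Minimality of the nearest point. [folklore] -/
theorem dist_nearestPt_le {K : Set E3} (hK : IsClosed K) (hc : Convex ℝ K) (hne : K.Nonempty)
    (v : E3) {x : E3} (hx : x ∈ K) : dist (nearestPt K v) v ≤ dist x v := by
  have h := norm_sq_le_inner_nearestPt hK hc hne v hx
  set c := nearestPt K v
  rw [dist_eq_norm, dist_eq_norm]
  have hcs := real_inner_le_norm (c - v) (x - v)
  by_cases h0 : ‖c - v‖ = 0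
  · rw [h0]; exact norm_nonneg _
  · have hpos : 0 < ‖c - v‖ := lt_of_le_of_ne (norm_nonneg _) (Ne.symm h0)
    nlinarith

/-- Uniqueness: a point of `K` at minimal distance from `v` is the nearest point (parallelogram
law: the midpoint of two minimisers would be closer). [folklore] -/
theorem nearestPt_eq_of_dist_le {K : Set E3} (hK : IsClosed K) (hc : Convex ℝ K) {c' : E3}
    (hc' : c' ∈ K) (v : E3) (hmin : ∀ x ∈ K, dist c' v ≤ dist x v) : nearestPt K v = c' := by
  have hne : K.Nonempty := ⟨c', hc'⟩
  have hcK := nearestPt_mem hK hc hne v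
  have h1 : dist (nearestPt K v) v ≤ dist c' v := dist_nearestPt_le hK hc hne v hc'
  have h2 : dist c' v ≤ dist (nearestPt K v) v := hmin _ hcK
  -- the midpoint of the two minimisers lies in `K`
  have hm : midpoint ℝ (nearestPt K v) c' ∈ K :=
    hc.segment_subset hcK hc' (midpoint_mem_segment _ _)
  have h3 : dist (nearestPt K v) v ≤ dist (midpoint ℝ (nearestPt K v) c') v :=
    dist_nearestPt_le hK hc hne v hm
  -- parallelogram law
  have hpar := parallelogram_law_with_norm ℝ (nearestPt K v - v) (c' - v)
  have e1 : nearestPt K v - v + (c' - v) = (2 : ℝ) • (midpoint ℝ (nearestPt K v) c' - v) := by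
    rw [midpoint_eq_smul_add, smul_sub, smul_smul]; norm_num
    simp only [two_smul]; abel
  have e2 : nearestPt K v - v - (c' - v) = nearestPt K v - c' := by abel
  rw [e1, e2, norm_smul, Real.norm_eq_abs, abs_of_pos (by norm_num : (0:ℝ) < 2)] at hpar
  rw [dist_eq_norm, dist_eq_norm] at h1 h2 h3
  have hδ : ‖nearestPt K v - v‖ = ‖c' - v‖ := le_antisymm h1 h2
  have h4 : ‖nearestPt K v - c'‖ * ‖nearestPt K v - c'‖ ≤ 0 := by
    nlinarith [norm_nonneg (nearestPt K v - v), norm_nonneg (midpoint ℝ (nearestPt K v) c' - v)]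
  have h5 : ‖nearestPt K v - c'‖ = 0 := by
    nlinarith [norm_nonneg (nearestPt K v - c')]
  exact sub_eq_zero.1 (norm_eq_zero.1 h5)


/-! ### B2. Blichfeldt's inequality for three and four centres -/

/-- **Blichfeldt, three centres**: a point at distance `R` from three centres pairwise `≥ 2`
apart has `R² ≥ 4/3`. [cite: Rogers1964, Ch. 7 §3, Lemma 1 (Blichfeldt’s inequality)] -/
theorem blichfeldt_three {p a b c : E3} {R : ℝ} (ha : dist a p = R) (hb : dist b p = R)
    (hc : dist c p = R) (hab : 2 ≤ dist a b) (hac : 2 ≤ dist a c) (hbc : 2 ≤ dist b c) :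
    4 / 3 ≤ R ^ 2 := by
  rw [dist_eq_norm] at ha hb hc hab hac hbc
  have e1 : a - b = (a - p) - (b - p) := by abel
  have e2 : a - c = (a - p) - (c - p) := by abel
  have e3 : b - c = (b - p) - (c - p) := by abel
  rw [e1] at hab; rw [e2] at hac; rw [e3] at hbc
  have h1 := norm_sub_sq_real (a - p) (b - p)
  have h2 := norm_sub_sq_real (a - p) (c - p)
  have h3 := norm_sub_sq_real (b - p) (c - p)
  have h4 := norm_add_sq_real (a - p) (b - p)
  have h5 := norm_add_sq_real (a - p + (b - p)) (c - p)
  rw [inner_add_left] at h5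
  have hsq1 : (2 : ℝ) ^ 2 ≤ ‖a - p - (b - p)‖ ^ 2 := pow_le_pow_left₀ (by norm_num) hab 2
  have hsq2 : (2 : ℝ) ^ 2 ≤ ‖a - p - (c - p)‖ ^ 2 := pow_le_pow_left₀ (by norm_num) hac 2
  have hsq3 : (2 : ℝ) ^ 2 ≤ ‖b - p - (c - p)‖ ^ 2 := pow_le_pow_left₀ (by norm_num) hbc 2
  rw [ha, hb] at h1 h4; rw [ha, hc] at h2; rw [hb, hc] at h3; rw [hc] at h5
  have h0 := sq_nonneg ‖a - p + (b - p) + (c - p)‖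
  linarith

/-- **Blichfeldt, four centres**: a point at distance `R` from four centres pairwise `≥ 2`
apart has `R² ≥ 3/2`. [cite: Rogers1964, Ch. 7 §3, Lemma 1 (Blichfeldt’s inequality)] -/
theorem blichfeldt_four {p a b c d : E3} {R : ℝ} (ha : dist a p = R) (hb : dist b p = R)
    (hc : dist c p = R) (hd : dist d p = R) (hab : 2 ≤ dist a b) (hac : 2 ≤ dist a c)
    (had : 2 ≤ dist a d) (hbc : 2 ≤ dist b c) (hbd : 2 ≤ dist b d) (hcd : 2 ≤ dist c d) :
    3 / 2 ≤ R ^ 2 := by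
  rw [dist_eq_norm] at ha hb hc hd hab hac had hbc hbd hcd
  set a' := a - p
  set b' := b - p
  set c' := c - p
  set d' := d - p
  have e1 : a - b = a' - b' := by simp [a', b']
  have e2 : a - c = a' - c' := by simp [a', c']
  have e3 : a - d = a' - d' := by simp [a', d']
  have e4 : b - c = b' - c' := by simp [b', c']
  have e5 : b - d = b' - d' := by simp [b', d']
  have e6 : c - d = c' - d' := by simp [c', d']
  rw [e1] at hab; rw [e2] at hac; rw [e3] at had; rw [e4] at hbc; rw [e5] at hbd; rw [e6] at hcd
  have h1 := norm_sub_sq_real a' b'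
  have h2 := norm_sub_sq_real a' c'
  have h3 := norm_sub_sq_real a' d'
  have h4 := norm_sub_sq_real b' c'
  have h5 := norm_sub_sq_real b' d'
  have h6 := norm_sub_sq_real c' d'
  have s1 := norm_add_sq_real a' b'
  have s2 := norm_add_sq_real (a' + b') c'
  have s3 := norm_add_sq_real (a' + b' + c') d'
  rw [inner_add_left] at s2
  rw [inner_add_left, inner_add_left] at s3
  have hsq1 : (2 : ℝ) ^ 2 ≤ ‖a' - b'‖ ^ 2 := pow_le_pow_left₀ (by norm_num) hab 2
  have hsq2 : (2 : ℝ) ^ 2 ≤ ‖a' - c'‖ ^ 2 := pow_le_pow_left₀ (by norm_num) hac 2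
  have hsq3 : (2 : ℝ) ^ 2 ≤ ‖a' - d'‖ ^ 2 := pow_le_pow_left₀ (by norm_num) had 2
  have hsq4 : (2 : ℝ) ^ 2 ≤ ‖b' - c'‖ ^ 2 := pow_le_pow_left₀ (by norm_num) hbc 2
  have hsq5 : (2 : ℝ) ^ 2 ≤ ‖b' - d'‖ ^ 2 := pow_le_pow_left₀ (by norm_num) hbd 2
  have hsq6 : (2 : ℝ) ^ 2 ≤ ‖c' - d'‖ ^ 2 := pow_le_pow_left₀ (by norm_num) hcd 2
  rw [ha, hb] at h1 s1; rw [ha, hc] at h2; rw [ha, hd] at h3; rw [hb, hc] at h4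
  rw [hb, hd] at h5; rw [hc, hd] at h6; rw [hc] at s2; rw [hd] at s3
  have h0 := sq_nonneg ‖a' + b' + c' + d'‖
  linarith

/-! ### B4. The slack functions of the Voronoi constraints -/

/-- The slack of the constraint "at least as close to `v` as to `k`":
`f_k(p) = dist(p, v)² − dist(p, k)²` (`≤ 0` on the Voronoi cell, `= 0` on the bisector).
[cite: HalesDSP2012, Definition 6.6 (the half-spaces `A₊(u, v)`)] -/
def slackFn (v k p : E3) : ℝ := dist p v ^ 2 - dist p k ^ 2

/-- The slack is an affine function: `f_k(p) = 2⟪p − v, k − v⟫ − ‖k − v‖²`. [folklore] -/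
theorem slackFn_eq (v k p : E3) : slackFn v k p = 2 * ⟪p - v, k - v⟫ - ‖k - v‖ ^ 2 := by
  rw [slackFn, dist_eq_norm, dist_eq_norm, show p - k = (p - v) - (k - v) by abel,
    norm_sub_sq_real (p - v) (k - v)]
  ring

/-- Affinity along lines. [folklore] -/
theorem slackFn_add_smul (v k p d : E3) (t : ℝ) :
    slackFn v k (p + t • d) = slackFn v k p + t * (2 * ⟪d, k - v⟫) := by
  rw [slackFn_eq, slackFn_eq, show p + t • d - v = (p - v) + t • d by abel, inner_add_left,
    real_inner_smul_left]
  ring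

/-- Affinity on segments (`AffineMap.lineMap` form). [folklore] -/
theorem slackFn_lineMap (v k a b : E3) (t : ℝ) :
    slackFn v k (AffineMap.lineMap a b t) = (1 - t) * slackFn v k a + t * slackFn v k b := by
  rw [AffineMap.lineMap_apply_module', show t • (b - a) + a = a + t • (b - a) by abel,
    slackFn_add_smul, slackFn_eq, slackFn_eq, show b - v = (b - a) + (a - v) by abel,
    inner_add_left]
  ring

/-- `f_k(v) = −‖k − v‖² < 0` for `k ≠ v`. [folklore] -/
theorem slackFn_self_lt (v : E3) {k : E3} (hk : k ≠ v) : slackFn v k v < 0 := by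
  rw [slackFn, dist_self]
  have : 0 < dist v k := dist_pos.2 hk.symm
  nlinarith

/-- On the Voronoi cell every slack is `≤ 0`. [folklore] -/
theorem slackFn_nonpos_of_mem {V : Set E3} {v p k : E3} (hp : p ∈ voronoiCell V v) (hk : k ∈ V) :
    slackFn v k p ≤ 0 := by
  have h := hp k hk
  rw [slackFn, sub_nonpos]
  exact pow_le_pow_left₀ dist_nonneg h 2

/-- `f_k(p) = 0` iff `p` is equidistant from `v` and `k`. [folklore] -/
theorem slackFn_eq_zero_iff (v k p : E3) : slackFn v k p = 0 ↔ dist p v = dist p k := by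
  rw [slackFn, sub_eq_zero, sq_eq_sq₀ dist_nonneg dist_nonneg]


/-! ### B5. The near centres and the ray-exit lemma -/

open Classical in
/-- The centres other than `v` within distance `< 4` of `v` (the only constraints that matter on
`B(v, 2) ⊇ Ω(V, v)`). [cite: HalesDSP2012, Lemma 6.7 (`V(v, 4)`)] -/
def nearSet (V : Set E3) (v : E3) : Finset E3 :=
  if h : (V ∩ ball v 4).Finite then h.toFinset.erase v else ∅

/-- Membership in the near set. [folklore] -/
theorem mem_nearSet {V : Set E3} (hV : IsUnitBallPacking V) {v k : E3} :
    k ∈ nearSet V v ↔ k ∈ V ∧ dist k v < 4 ∧ k ≠ v := by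
  rw [nearSet, dif_pos (finite_inter_ball_of_packing hV v 4), Finset.mem_erase,
    Set.Finite.mem_toFinset]
  simp only [mem_inter_iff, mem_ball]
  tauto

/-- On `B(v, 2)` membership in the Voronoi cell is decided by the near constraints.
[cite: HalesDSP2012, Lemma 6.7] -/
theorem mem_voronoiCell_iff_slackFn {V : Set E3} (hV : IsUnitBallPacking V) {v p : E3}
    (hp : p ∈ ball v 2) :
    p ∈ voronoiCell V v ↔ ∀ k ∈ nearSet V v, slackFn v k p ≤ 0 := by
  constructor
  · intro h k hk
    exact slackFn_nonpos_of_mem h ((mem_nearSet hV).1 hk).1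
  · intro h w hw
    by_cases hwv : w = v
    · rw [hwv]
    by_cases hnear : dist w v < 4
    · have := h w ((mem_nearSet hV).2 ⟨hw, hnear, hwv⟩)
      rw [slackFn, sub_nonpos] at this
      exact (pow_le_pow_iff_left₀ dist_nonneg dist_nonneg two_ne_zero).1 this
    · push Not at hnear
      rw [mem_ball] at hp
      have := dist_triangle w p v
      rw [dist_comm w p] at this
      linarith

/-- **Ray-exit lemma.** From a point `p₀` of the cell, the ray in direction `d ≠ 0` leaves the
(compact) cell at a last parameter `T`; at the exit point some near constraint `k` is tight and
strictly increasing along the ray.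
[cite: HalesDSP2012, Lemma 5.56 (proof)] [cite: Rogers1964, Ch. 7 §2] -/
theorem ray_exit {V : Set E3} (hV : IsUnitBallPacking V) (hsat : IsSaturated V) {v : E3}
    {p₀ d : E3} (hp₀ : p₀ ∈ voronoiCell V v) (hd : d ≠ 0) :
    ∃ T : ℝ, 0 ≤ T ∧ p₀ + T • d ∈ voronoiCell V v ∧
      (∀ t : ℝ, 0 ≤ t → p₀ + t • d ∈ voronoiCell V v → t ≤ T) ∧
      ∃ k ∈ nearSet V v, slackFn v k (p₀ + T • d) = 0 ∧ 0 < ⟪d, k - v⟫ := by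
  set Ω := voronoiCell V v with hΩ
  set S : Set ℝ := {t | 0 ≤ t ∧ p₀ + t • d ∈ Ω} with hS
  have hcont : Continuous fun t : ℝ => p₀ + t • d := by fun_prop
  have hS0 : (0 : ℝ) ∈ S := ⟨le_rfl, by simpa using hp₀⟩
  have hSbdd : BddAbove S := by
    refine ⟨4 / ‖d‖, fun t ht => ?_⟩
    have h1 : p₀ + t • d ∈ ball v 2 := voronoiCell_subset_ball hsat v ht.2
    have h2 : p₀ ∈ ball v 2 := voronoiCell_subset_ball hsat v hp₀
    rw [mem_ball, dist_eq_norm] at h1 h2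
    have hdpos : 0 < ‖d‖ := norm_pos_iff.2 hd
    rw [le_div_iff₀ hdpos]
    have h3 : ‖t • d‖ ≤ ‖p₀ + t • d - v‖ + ‖p₀ - v‖ :=
      calc ‖t • d‖ = ‖(p₀ + t • d - v) - (p₀ - v)‖ := by congr 1; abel
        _ ≤ _ := norm_sub_le _ _
    rw [norm_smul, Real.norm_eq_abs, abs_of_nonneg ht.1] at h3
    linarith
  have hSclosed : IsClosed S :=
    isClosed_Ici.inter ((isClosed_voronoiCell V v).preimage hcont)
  set T := sSup S with hT
  have hTS : T ∈ S := hSclosed.csSup_mem ⟨0, hS0⟩ hSbdd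
  have hle : ∀ t ∈ S, t ≤ T := fun t ht => le_csSup hSbdd ht
  refine ⟨T, hTS.1, hTS.2, fun t ht0 ht => hle t ⟨ht0, ht⟩, ?_⟩
  by_contra H
  push Not at H
  -- the constraints with positive slope are strictly slack at the exit point
  set Npos := (nearSet V v).filter fun k => 0 < ⟪d, k - v⟫ with hNpos
  have hneg : ∀ k ∈ Npos, slackFn v k (p₀ + T • d) < 0 := by
    intro k hk
    rw [hNpos, Finset.mem_filter] at hk
    have h1 : slackFn v k (p₀ + T • d) ≤ 0 :=
      slackFn_nonpos_of_mem hTS.2 ((mem_nearSet hV).1 hk.1).1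
    exact lt_of_le_of_ne h1 fun h0 => (H k hk.1 h0).not_gt hk.2
  -- an open neighbourhood of the exit point in which one can continue
  set U : Set E3 := ball v 2 ∩ ⋂ k ∈ Npos, {p | slackFn v k p < 0} with hU
  have hUopen : IsOpen U := by
    refine isOpen_ball.inter (isOpen_biInter_finset fun k _ => ?_)
    exact isOpen_lt (by unfold slackFn; fun_prop) continuous_const
  have heU : p₀ + T • d ∈ U := by
    refine ⟨voronoiCell_subset_ball hsat v hTS.2, ?_⟩
    simp only [mem_iInter, mem_setOf_eq]
    exact fun k hk => hneg k hk
  have hev : ∀ᶠ t in 𝓝 T, p₀ + t • d ∈ U :=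
    hcont.continuousAt.preimage_mem_nhds (hUopen.mem_nhds heU)
  obtain ⟨t, htT, htU⟩ := hev.exists_gt
  have htΩ : p₀ + t • d ∈ Ω := by
    rw [hΩ, mem_voronoiCell_iff_slackFn hV htU.1]
    intro k hk
    by_cases hslope : 0 < ⟪d, k - v⟫
    · have hk' : k ∈ Npos := by rw [hNpos, Finset.mem_filter]; exact ⟨hk, hslope⟩
      have := htU.2
      simp only [mem_iInter, mem_setOf_eq] at this
      exact (this k hk').le
    · push Not at hslope
      have e : p₀ + t • d = (p₀ + T • d) + (t - T) • d := by rw [sub_smul]; abel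
      rw [e, slackFn_add_smul]
      have h1 : slackFn v k (p₀ + T • d) ≤ 0 :=
        slackFn_nonpos_of_mem hTS.2 ((mem_nearSet hV).1 hk).1
      nlinarith
  have := hle t ⟨hTS.1.trans htT.le, htΩ⟩
  linarith

/-- **Ray-exit through a second point**: the ray from `p₀` through another point `z` of the cell
leaves the cell at `e` beyond `z`, where a near constraint is tight that is strictly slack at `p₀`.
[cite: HalesDSP2012, Lemma 5.56 (proof)] [cite: Rogers1964, Ch. 7 §2] -/
theorem ray_exit_through {V : Set E3} (hV : IsUnitBallPacking V) (hsat : IsSaturated V)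
    {v p₀ z : E3} (hp₀ : p₀ ∈ voronoiCell V v) (hz : z ∈ voronoiCell V v) (hne : z ≠ p₀) :
    ∃ T : ℝ, 1 ≤ T ∧ p₀ + T • (z - p₀) ∈ voronoiCell V v ∧
      (∀ t : ℝ, 0 ≤ t → p₀ + t • (z - p₀) ∈ voronoiCell V v → t ≤ T) ∧
      ∃ k ∈ nearSet V v, slackFn v k (p₀ + T • (z - p₀)) = 0 ∧ slackFn v k p₀ < 0 := by
  obtain ⟨T, hT0, hTmem, hTmax, k, hk, hk0, hslope⟩ :=
    ray_exit hV hsat hp₀ (sub_ne_zero.2 hne)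
  have hT1 : 1 ≤ T := hTmax 1 zero_le_one (by simpa using hz)
  refine ⟨T, hT1, hTmem, hTmax, k, hk, hk0, ?_⟩
  have e : p₀ = (p₀ + T • (z - p₀)) + (-T) • (z - p₀) := by rw [neg_smul]; abel
  rw [e, slackFn_add_smul, hk0]
  nlinarith


/-! ### B3. Lines: vectors orthogonal to two independent vectors (cross products) -/

/-- A vector orthogonal (for the dot product) to `n` and `m` is a multiple of `n × m` when the
latter is non-zero. [folklore] -/
theorem exists_eq_smul_cross {n m x : Fin 3 → ℝ} (h : n ⨯₃ m ≠ 0) (hn : x ⬝ᵥ n = 0)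
    (hm : x ⬝ᵥ m = 0) : ∃ r : ℝ, x = r • (n ⨯₃ m) := by
  set d := n ⨯₃ m with hd
  have h1 : d ⨯₃ x = 0 := by
    rw [hd, cross_cross_eq_smul_sub_smul, dotProduct_comm n x, dotProduct_comm m x, hn, hm]
    simp
  have h2 : (d ⬝ᵥ d) * (x ⬝ᵥ x) - (d ⬝ᵥ x) * (x ⬝ᵥ d) = 0 := by
    rw [← cross_dot_cross, h1]; simp
  have hdd : d ⬝ᵥ d ≠ 0 := fun h0 => h (dotProduct_self_eq_zero.1 h0)
  refine ⟨(d ⬝ᵥ x) / (d ⬝ᵥ d), ?_⟩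
  have hy : (x - ((d ⬝ᵥ x) / (d ⬝ᵥ d)) • d) ⬝ᵥ (x - ((d ⬝ᵥ x) / (d ⬝ᵥ d)) • d) = 0 := by
    simp only [sub_dotProduct, dotProduct_sub, dotProduct_smul, smul_dotProduct, smul_eq_mul]
    rw [dotProduct_comm x d] at h2 ⊢
    field_simp
    linear_combination h2
  exact sub_eq_zero.1 (dotProduct_self_eq_zero.1 hy)

/-- The cross product of two vectors of `E3` (through coordinates). [folklore] -/
def crossE (u w : E3) : E3 := WithLp.toLp 2 (WithLp.ofLp u ⨯₃ WithLp.ofLp w)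

/-- A vector of `E3` orthogonal to `u` and `w` is a multiple of `crossE u w` when the latter is
non-zero. [folklore] -/
theorem exists_eq_smul_crossE {u w x : E3} (h : crossE u w ≠ 0) (hu : ⟪x, u⟫ = 0)
    (hw : ⟪x, w⟫ = 0) : ∃ r : ℝ, x = r • crossE u w := by
  have h' : WithLp.ofLp u ⨯₃ WithLp.ofLp w ≠ 0 := by
    intro h0; apply h; rw [crossE, h0]; rfl
  rw [EuclideanSpace.inner_eq_star_dotProduct, star_trivial, dotProduct_comm] at hu hw
  obtain ⟨r, hr⟩ := exists_eq_smul_cross h' hu hw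
  refine ⟨r, ?_⟩
  have : WithLp.toLp 2 (WithLp.ofLp x) =
      WithLp.toLp 2 (r • (WithLp.ofLp u ⨯₃ WithLp.ofLp w)) := by rw [hr]
  simpa [crossE, WithLp.toLp_smul] using this

/-- Parallel case: if two distinct centres `i, j ≠ v` have tight bisector constraints at a common
point then `crossE (i − v) (j − v) ≠ 0` (otherwise `v, i, j` are collinear and the two bisector
planes are parallel and distinct). [folklore] -/
theorem crossE_ne_zero_of_tight {v i j p : E3} (hi : i ≠ v) (hj : j ≠ v) (hij : i ≠ j)
    (hpi : slackFn v i p = 0) (hpj : slackFn v j p = 0) : crossE (i - v) (j - v) ≠ 0 := by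
  intro h0
  have hx : WithLp.ofLp (i - v) ≠ 0 := by
    intro h1; apply hi
    have : i - v = 0 := by
      have := congrArg (WithLp.toLp 2) h1; simpa using this
    exact sub_eq_zero.1 this
  have hdep : ¬ LinearIndependent ℝ ![WithLp.ofLp (i - v), WithLp.ofLp (j - v)] := by
    rw [← crossProduct_ne_zero_iff_linearIndependent]
    intro hne; apply hne
    have := congrArg WithLp.ofLp h0
    simpa [crossE] using this
  rw [LinearIndependent.pair_iff' hx] at hdep
  push Not at hdep
  obtain ⟨a, ha⟩ := hdep
  have ha' : j - v = a • (i - v) := by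
    have := congrArg (WithLp.toLp 2) ha
    simpa [WithLp.toLp_smul] using this.symm
  rw [slackFn_eq] at hpi hpj
  rw [ha', inner_smul_right, norm_smul, mul_pow, Real.norm_eq_abs, sq_abs] at hpj
  have hn : 0 < ‖i - v‖ ^ 2 := by
    have : 0 < ‖i - v‖ := norm_pos_iff.2 (sub_ne_zero.2 hi); positivity
  -- from hpi: 2⟪p−v,i−v⟫ = ‖i−v‖²; from hpj: 2a⟪p−v,i−v⟫ = a²‖i−v‖²  ⇒ a = a²
  have h1 : a * ‖i - v‖ ^ 2 = a ^ 2 * ‖i - v‖ ^ 2 := by linear_combination hpj - a * hpi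
  have h2 : a = a ^ 2 := by
    have := mul_right_cancel₀ hn.ne' h1; exact this
  have h3 : a = 0 ∨ a = 1 := by
    have : a * (a - 1) = 0 := by nlinarith
    rcases mul_eq_zero.1 this with h | h
    · exact Or.inl h
    · exact Or.inr (by linarith)
  rcases h3 with rfl | rfl
  · apply hj; rw [zero_smul] at ha'; exact sub_eq_zero.1 ha'
  · apply hij; rw [one_smul] at ha'; exact (sub_left_inj.1 ha').symm


/-! ### B6. Bisectors, faces, nearest points of faces -/

/-- The bisector plane of `v` and `k` as the zero set of the slack. [folklore] -/
def bis (v k : E3) : Set E3 := {p | slackFn v k p = 0}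

/-- Membership in the bisector. [folklore] -/
theorem mem_bis {v k p : E3} : p ∈ bis v k ↔ slackFn v k p = 0 := Iff.rfl

/-- The slack functions are continuous. [folklore] -/
theorem continuous_slackFn (v k : E3) : Continuous (slackFn v k) := by
  unfold slackFn; fun_prop

/-- Bisectors are closed. [folklore] -/
theorem isClosed_bis (v k : E3) : IsClosed (bis v k) :=
  isClosed_eq (continuous_slackFn v k) continuous_const

/-- Bisectors are convex (affine level sets). [folklore] -/
theorem convex_bis (v k : E3) : Convex ℝ (bis v k) := by
  intro x hx y hy a b ha hb hab
  rw [mem_bis] at hx hy ⊢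
  have e : a • x + b • y = AffineMap.lineMap x y b := by
    rw [AffineMap.lineMap_apply_module', show a = 1 - b by linarith]; module
  rw [e, slackFn_lineMap, hx, hy]; ring

/-- Two points of a bisector differ by a vector orthogonal to `k − v`. [folklore] -/
theorem inner_sub_eq_zero_of_mem_bis {v k w z : E3} (hw : w ∈ bis v k) (hz : z ∈ bis v k) :
    ⟪w - z, k - v⟫ = 0 := by
  rw [mem_bis, slackFn_eq] at hw hz
  rw [show w - z = (w - v) - (z - v) by abel, inner_sub_left]
  linarith

/-- **Line lemma**: two points tight for two distinct near centres `i, j ≠ v` differ by a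
multiple of `crossE (i − v) (j − v)`. [folklore] -/
theorem exists_sub_eq_smul_of_mem_bis {v i j w z : E3} (hi : i ≠ v) (hj : j ≠ v) (hij : i ≠ j)
    (hwi : w ∈ bis v i) (hwj : w ∈ bis v j) (hzi : z ∈ bis v i) (hzj : z ∈ bis v j) :
    ∃ r : ℝ, w - z = r • crossE (i - v) (j - v) :=
  exists_eq_smul_crossE (crossE_ne_zero_of_tight hi hj hij hwi hwj)
    (inner_sub_eq_zero_of_mem_bis hwi hzi) (inner_sub_eq_zero_of_mem_bis hwj hzj)

/-- Collinearity on a line of two bisectors: a third point is on the affine line through two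
distinct ones. [folklore] -/
theorem exists_eq_lineMap_of_mem_bis {v i j w z y : E3} (hi : i ≠ v) (hj : j ≠ v) (hij : i ≠ j)
    (hwi : w ∈ bis v i) (hwj : w ∈ bis v j) (hzi : z ∈ bis v i) (hzj : z ∈ bis v j)
    (hyi : y ∈ bis v i) (hyj : y ∈ bis v j) (hzy : z ≠ y) :
    ∃ ρ : ℝ, w = AffineMap.lineMap z y ρ := by
  obtain ⟨r, hr⟩ := exists_sub_eq_smul_of_mem_bis hi hj hij hwi hwj hzi hzj
  obtain ⟨r', hr'⟩ := exists_sub_eq_smul_of_mem_bis hi hj hij hyi hyj hzi hzj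
  have hr0 : r' ≠ 0 := by
    rintro rfl; rw [zero_smul, sub_eq_zero] at hr'; exact hzy hr'.symm
  refine ⟨r / r', ?_⟩
  rw [AffineMap.lineMap_apply_module', hr', smul_smul, div_mul_cancel₀ _ hr0, ← hr]; abel

variable (V : Set E3) (v : E3)

/-- The facet piece `F¹ᵢ = Ω ∩ bis i`.
[cite: Rogers1964, Ch. 7 §2] [cite: HalesDSP2012, Definition 6.17 (`Ω(V, [u₀; u₁])`)] -/
def face1 (i : E3) : Set E3 := voronoiCell V v ∩ bis v i
/-- The edge piece `F²ᵢⱼ = F¹ᵢ ∩ bis j`.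
[cite: Rogers1964, Ch. 7 §2] [cite: HalesDSP2012, Definition 6.17] -/
def face2 (i j : E3) : Set E3 := face1 V v i ∩ bis v j
/-- The vertex piece `F³ᵢⱼₖ = F²ᵢⱼ ∩ bis k`.
[cite: Rogers1964, Ch. 7 §2] [cite: HalesDSP2012, Definition 6.17] -/
def face3 (i j k : E3) : Set E3 := face2 V v i j ∩ bis v k

/-- Rogers's points `c₁, c₂, c₃`: nearest points of the faces to the centre `v`.
[cite: Rogers1964, Ch. 7 §2 ("the point of the (n−i)-dimensional face … nearest to a")] -/
def cpt1 (i : E3) : E3 := nearestPt (face1 V v i) v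
/-- See `cpt1`. [cite: Rogers1964, Ch. 7 §2] -/
def cpt2 (i j : E3) : E3 := nearestPt (face2 V v i j) v
/-- See `cpt1`. [cite: Rogers1964, Ch. 7 §2] -/
def cpt3 (i j k : E3) : E3 := nearestPt (face3 V v i j k) v

/-- The edge vectors of the Rogers simplex of the triple `(i, j, k)`.
[cite: Rogers1964, Ch. 7 §2 (the simplices `c₀ c₁ … cₙ`)] -/
def pieceVec (τ : E3 × E3 × E3) : Fin 3 → E3 :=
  ![cpt1 V v τ.1 - v, cpt2 V v τ.1 τ.2.1 - v, cpt3 V v τ.1 τ.2.1 τ.2.2 - v]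

variable {V v}

/-- Faces are closed. [folklore] -/
theorem isClosed_face1 (i : E3) : IsClosed (face1 V v i) :=
  (isClosed_voronoiCell V v).inter (isClosed_bis v i)
/-- Faces are closed. [folklore] -/
theorem isClosed_face2 (i j : E3) : IsClosed (face2 V v i j) :=
  (isClosed_face1 i).inter (isClosed_bis v j)
/-- Faces are closed. [folklore] -/
theorem isClosed_face3 (i j k : E3) : IsClosed (face3 V v i j k) :=
  (isClosed_face2 i j).inter (isClosed_bis v k)
/-- Faces are convex. [folklore] -/
theorem convex_face1 (i : E3) : Convex ℝ (face1 V v i) :=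
  (convex_voronoiCell V v).inter (convex_bis v i)
/-- Faces are convex. [folklore] -/
theorem convex_face2 (i j : E3) : Convex ℝ (face2 V v i j) :=
  (convex_face1 i).inter (convex_bis v j)
/-- Faces are convex. [folklore] -/
theorem convex_face3 (i j k : E3) : Convex ℝ (face3 V v i j k) :=
  (convex_face2 i j).inter (convex_bis v k)
/-- `F² ⊆ F¹`. [folklore] -/
theorem face2_subset_face1 (i j : E3) : face2 V v i j ⊆ face1 V v i := inter_subset_left
/-- `F³ ⊆ F²`. [folklore] -/
theorem face3_subset_face2 (i j k : E3) : face3 V v i j k ⊆ face2 V v i j := inter_subset_left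
/-- `F¹ ⊆ Ω`. [folklore] -/
theorem face1_subset (i : E3) : face1 V v i ⊆ voronoiCell V v := inter_subset_left

/-- `c₁ ∈ F¹` when `F¹ ≠ ∅`. [folklore] -/
theorem cpt1_mem {i : E3} (h : (face1 V v i).Nonempty) : cpt1 V v i ∈ face1 V v i :=
  nearestPt_mem (isClosed_face1 i) (convex_face1 i) h v
/-- `c₂ ∈ F²` when `F² ≠ ∅`. [folklore] -/
theorem cpt2_mem {i j : E3} (h : (face2 V v i j).Nonempty) : cpt2 V v i j ∈ face2 V v i j :=
  nearestPt_mem (isClosed_face2 i j) (convex_face2 i j) h v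
/-- `c₃ ∈ F³` when `F³ ≠ ∅`. [folklore] -/
theorem cpt3_mem {i j k : E3} (h : (face3 V v i j k).Nonempty) :
    cpt3 V v i j k ∈ face3 V v i j k :=
  nearestPt_mem (isClosed_face3 i j k) (convex_face3 i j k) h v

/-- Variational inequality at `c₁`: `⟪c₁ − v, x − v⟫ ≥ ‖c₁ − v‖²` for `x ∈ F¹`. [folklore] -/
theorem norm_sq_le_inner_cpt1 {i x : E3} (hx : x ∈ face1 V v i) :
    ‖cpt1 V v i - v‖ ^ 2 ≤ ⟪cpt1 V v i - v, x - v⟫ :=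
  norm_sq_le_inner_nearestPt (isClosed_face1 i) (convex_face1 i) ⟨x, hx⟩ v hx
/-- Variational inequality at `c₂`: `⟪c₂ − v, x − v⟫ ≥ ‖c₂ − v‖²` for `x ∈ F²`. [folklore] -/
theorem norm_sq_le_inner_cpt2 {i j x : E3} (hx : x ∈ face2 V v i j) :
    ‖cpt2 V v i j - v‖ ^ 2 ≤ ⟪cpt2 V v i j - v, x - v⟫ :=
  norm_sq_le_inner_nearestPt (isClosed_face2 i j) (convex_face2 i j) ⟨x, hx⟩ v hx

/-! ### B7. Rogers's Gram conditions for the pieces -/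

/-- A point tight for the near centre `i` is at distance `≥ 1` from `v`.
[cite: Rogers1964, Ch. 7 §3, Lemma 1 (`i = 1`)] -/
theorem one_le_norm_sq_of_mem_bis {V : Set E3} (hV : IsUnitBallPacking V) {v i p : E3}
    (hv : v ∈ V) (hi : i ∈ V) (hiv : i ≠ v) (hp : p ∈ bis v i) : 1 ≤ ‖p - v‖ ^ 2 := by
  rw [mem_bis, slackFn_eq_zero_iff] at hp
  have h2 := hV.two_le_dist hv hi hiv.symm
  have ht := dist_triangle v p i
  rw [dist_comm v p, ← hp, ← dist_eq_norm] at *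
  nlinarith [dist_nonneg (x := p) (y := v)]

/-- **The pieces satisfy Rogers's Gram conditions.** [cite: Rogers1964, Ch. 7 §3, Lemma 2] -/
theorem isRogersGram_pieceVec {V : Set E3} (hV : IsUnitBallPacking V) {v i j k : E3} (hv : v ∈ V)
    (hi : i ∈ nearSet V v) (hj : j ∈ nearSet V v) (hk : k ∈ nearSet V v) (hij : i ≠ j)
    (hik : i ≠ k) (hjk : j ≠ k) (hne : (face3 V v i j k).Nonempty) :
    IsRogersGram (pieceVec V v (i, j, k)) := by
  obtain ⟨hiV, -, hiv⟩ := (mem_nearSet hV).1 hi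
  obtain ⟨hjV, -, hjv⟩ := (mem_nearSet hV).1 hj
  obtain ⟨hkV, -, hkv⟩ := (mem_nearSet hV).1 hk
  have hne2 : (face2 V v i j).Nonempty := hne.mono (face3_subset_face2 i j k)
  have hne1 : (face1 V v i).Nonempty := hne2.mono (face2_subset_face1 i j)
  have h3 := cpt3_mem hne
  have h2 := cpt2_mem hne2
  have h1 := cpt1_mem hne1
  -- diagonal bounds
  have d1 : 1 ≤ ‖cpt1 V v i - v‖ ^ 2 := one_le_norm_sq_of_mem_bis hV hv hiV hiv h1.2
  have d2 : 4 / 3 ≤ ‖cpt2 V v i j - v‖ ^ 2 := by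
    have hbi : slackFn v i (cpt2 V v i j) = 0 := h2.1.2
    have hbj : slackFn v j (cpt2 V v i j) = 0 := h2.2
    rw [slackFn_eq_zero_iff] at hbi hbj
    rw [← dist_eq_norm]
    exact blichfeldt_three (p := cpt2 V v i j) (dist_comm _ _) (by rw [dist_comm, ← hbi])
      (by rw [dist_comm, ← hbj]) (hV.two_le_dist hv hiV hiv.symm) (hV.two_le_dist hv hjV hjv.symm)
      (hV.two_le_dist hiV hjV hij)
  have d3 : 3 / 2 ≤ ‖cpt3 V v i j k - v‖ ^ 2 := by
    have hbi : slackFn v i (cpt3 V v i j k) = 0 := h3.1.1.2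
    have hbj : slackFn v j (cpt3 V v i j k) = 0 := h3.1.2
    have hbk : slackFn v k (cpt3 V v i j k) = 0 := h3.2
    rw [slackFn_eq_zero_iff] at hbi hbj hbk
    rw [← dist_eq_norm]
    exact blichfeldt_four (p := cpt3 V v i j k) (dist_comm _ _) (by rw [dist_comm, ← hbi])
      (by rw [dist_comm, ← hbj]) (by rw [dist_comm, ← hbk]) (hV.two_le_dist hv hiV hiv.symm)
      (hV.two_le_dist hv hjV hjv.symm) (hV.two_le_dist hv hkV hkv.symm)
      (hV.two_le_dist hiV hjV hij) (hV.two_le_dist hiV hkV hik) (hV.two_le_dist hjV hkV hjk)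
  -- cross terms
  have c12 := norm_sq_le_inner_cpt1 (h2.1)
  have c13 := norm_sq_le_inner_cpt1 (h3.1.1)
  have c23 := norm_sq_le_inner_cpt2 (h3.1)
  have n1 := norm_nonneg (cpt1 V v i - v)
  have n2 := norm_nonneg (cpt2 V v i j - v)
  have n3 := norm_nonneg (cpt3 V v i j k - v)
  have s1 := real_inner_self_eq_norm_sq (cpt1 V v i - v)
  have s2 := real_inner_self_eq_norm_sq (cpt2 V v i j - v)
  have s3 := real_inner_self_eq_norm_sq (cpt3 V v i j k - v)
  intro a b hab
  fin_cases a <;> fin_cases b <;>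
    simp [rogersGramConst, pieceVec] at hab ⊢ <;> nlinarith

/-! ### B8. The pieces lie in the cell -/

/-- A simplex with apex and the three other vertices in a convex set lies in it. [folklore] -/
theorem rogersSimplex_subset_of_convex {K : Set E3} (hK : Convex ℝ K) {v : E3} (hv : v ∈ K)
    {c : Fin 3 → E3} (hc : ∀ m, v + c m ∈ K) : rogersSimplex v c ⊆ K := by
  rintro x ⟨t, ⟨ht0, ht1⟩, rfl⟩
  show v + edgeMap c t ∈ K
  rw [edgeMap_apply]
  have e : v + ∑ m, t m • c m = (1 - ∑ m, t m) • v + ∑ m, t m • (v + c m) := by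
    simp only [smul_add, Finset.sum_add_distrib, ← Finset.sum_smul]
    module
  rw [e]
  -- a convex combination of `v` and the `v + c m`
  have := hK.sum_mem (t := Finset.univ) (w := Fin.cons (1 - ∑ m, t m) t)
    (z := Fin.cons v fun m => v + c m) ?_ ?_ ?_
  · simpa [Fin.sum_univ_succ] using this
  · intro m _
    refine Fin.cases ?_ (fun m => ?_) m
    · simpa using ht1
    · simpa using ht0 m
  · simp [Fin.sum_univ_succ]
  · intro m _
    refine Fin.cases ?_ (fun m => ?_) m
    · simpa using hv
    · simpa using hc m

/-- **The Rogers simplex of a good triple lies in the cell** (its vertices `v, c₁, c₂, c₃` do and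
the cell is convex). [cite: Rogers1964, Ch. 7 §2] -/
theorem pieceVec_subset {V : Set E3} (hV : IsUnitBallPacking V) {v i j k : E3} (hv : v ∈ V)
    (hne : (face3 V v i j k).Nonempty) :
    rogersSimplex v (pieceVec V v (i, j, k)) ⊆ voronoiCell V v := by
  have hne2 : (face2 V v i j).Nonempty := hne.mono (face3_subset_face2 i j k)
  have hne1 : (face1 V v i).Nonempty := hne2.mono (face2_subset_face1 i j)
  refine rogersSimplex_subset_of_convex (convex_voronoiCell V v)
    (closedBall_subset_voronoiCell hV hv (mem_closedBall_self zero_le_one)) fun m => ?_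
  fin_cases m
  · simpa [pieceVec] using (cpt1_mem hne1).1
  · simpa [pieceVec] using (cpt2_mem hne2).1.1
  · simpa [pieceVec] using (cpt3_mem hne).1.1.1


/-! ### B9. Covering -/

/-- Membership in a simplex from explicit barycentric data. [folklore] -/
theorem mem_rogersSimplex_of_eq {v x : E3} {c : Fin 3 → E3} (t0 t1 t2 : ℝ) (h0 : 0 ≤ t0)
    (h1 : 0 ≤ t1) (h2 : 0 ≤ t2) (hs : t0 + t1 + t2 ≤ 1)
    (hx : x = v + (t0 • c 0 + t1 • c 1 + t2 • c 2)) : x ∈ rogersSimplex v c := by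
  refine ⟨!₂[t0, t1, t2], ⟨?_, ?_⟩, ?_⟩
  · intro m; fin_cases m <;> simp [h0, h1, h2]
  · simp [Fin.sum_univ_three]; linarith
  · show v + edgeMap c _ = x
    rw [hx, edgeMap_apply]; simp [Fin.sum_univ_three]

/-- Points of the line through two points of a bisector stay in it. [folklore] -/
theorem add_smul_sub_mem_bis {v k a b : E3} (ha : a ∈ bis v k) (hb : b ∈ bis v k) (t : ℝ) :
    a + t • (b - a) ∈ bis v k := by
  rw [mem_bis] at ha hb ⊢
  have := slackFn_lineMap v k a b t
  rw [AffineMap.lineMap_apply_module', add_comm] at this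
  rw [this, ha, hb]; ring

/-- Under saturation there is a near centre. [folklore] -/
theorem nearSet_nonempty {V : Set E3} (hV : IsUnitBallPacking V) (hsat : IsSaturated V) (v : E3) :
    (nearSet V v).Nonempty := by
  -- a point at distance `2` from `v` has a centre within distance `< 2`, which is near and `≠ v`
  set p : E3 := v + (2 : ℝ) • EuclideanSpace.single 0 1 with hp
  have hpv : dist p v = 2 := by
    rw [hp, dist_eq_norm, add_sub_cancel_left, norm_smul]; simp
  obtain ⟨u, hu, hup⟩ := hsat p
  refine ⟨u, (mem_nearSet hV).2 ⟨hu, ?_, ?_⟩⟩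
  · calc dist u v ≤ dist u p + dist p v := dist_triangle u p v
      _ < 2 + 2 := by rw [hpv]; linarith
      _ = 4 := by norm_num
  · rintro rfl
    rw [dist_comm] at hup
    linarith

/-- A face of a singleton-or-less type: if `w ↦ slackFn v k w` has a negative value at `c₂` and
vanishes at `e₃ ≠ c₂` on the line `bis i ∩ bis j`, then `face3 i j k ⊆ {e₃}`. [folklore] -/
theorem face3_subset_singleton {V : Set E3} {v i j k c e : E3} (hiv : i ≠ v) (hjv : j ≠ v)
    (hij : i ≠ j) (hci : c ∈ bis v i) (hcj : c ∈ bis v j) (hei : e ∈ bis v i) (hej : e ∈ bis v j)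
    (hce : c ≠ e) (hkc : slackFn v k c < 0) (hke : slackFn v k e = 0) :
    face3 V v i j k ⊆ {e} := by
  intro w hw
  obtain ⟨ρ, hρ⟩ := exists_eq_lineMap_of_mem_bis hiv hjv hij hw.1.1.2 hw.1.2 hci hcj hei hej hce
  have h0 : slackFn v k w = 0 := hw.2
  rw [hρ, slackFn_lineMap, hke, mul_zero, add_zero] at h0
  have h1 : 1 - ρ = 0 := by
    rcases mul_eq_zero.1 h0 with h | h
    · exact h
    · exact absurd h hkc.ne
  have : ρ = 1 := by linarith
  rw [mem_singleton_iff, hρ, this, AffineMap.lineMap_apply_one]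

/-- **Covering.** Every point of the cell lies in the Rogers simplex of a good triple, or in one
of finitely many degenerate (planar) triangles `conv{v, c₁(i), c₂(i,j)}`.
[cite: Rogers1964, Ch. 7 §2] [cite: HalesDSP2012, Lemma 6.26] -/
theorem cover {V : Set E3} (hV : IsUnitBallPacking V) (hsat : IsSaturated V) {v : E3} (hv : v ∈ V)
    {x : E3} (hx : x ∈ voronoiCell V v) :
    (∃ i ∈ nearSet V v, ∃ j ∈ nearSet V v, ∃ k ∈ nearSet V v, i ≠ j ∧ i ≠ k ∧ j ≠ k ∧
        (face3 V v i j k).Nonempty ∧ x ∈ rogersSimplex v (pieceVec V v (i, j, k))) ∨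
    (∃ i ∈ nearSet V v, ∃ j ∈ nearSet V v,
        x ∈ rogersSimplex v ![cpt1 V v i - v, cpt2 V v i j - v, 0]) := by
  have hvΩ : v ∈ voronoiCell V v :=
    closedBall_subset_voronoiCell hV hv (mem_closedBall_self zero_le_one)
  obtain ⟨i₀, hi₀⟩ := nearSet_nonempty hV hsat v
  by_cases hxv : x = v
  · right
    refine ⟨i₀, hi₀, i₀, hi₀, mem_rogersSimplex_of_eq 0 0 0 le_rfl le_rfl le_rfl (by norm_num) ?_⟩
    simp [hxv]
  -- first exit: from `v` through `x`
  obtain ⟨T, hT1, he1, -, i, hi, hi0, -⟩ := ray_exit_through hV hsat hvΩ hx hxv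
  obtain ⟨hiV, -, hiv⟩ := (mem_nearSet hV).1 hi
  set e1 := v + T • (x - v) with he1def
  have hT : 0 < T := by linarith
  have hxe1 : x - v = T⁻¹ • (e1 - v) := by
    rw [he1def, add_sub_cancel_left, smul_smul, inv_mul_cancel₀ hT.ne', one_smul]
  have he1F : e1 ∈ face1 V v i := ⟨he1, hi0⟩
  have hne1 : (face1 V v i).Nonempty := ⟨e1, he1F⟩
  have hc1 := cpt1_mem hne1
  set c1 := cpt1 V v i with hc1def
  have hα0 : 0 ≤ T⁻¹ := by positivity
  have hα1 : T⁻¹ ≤ 1 := inv_le_one_of_one_le₀ hT1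
  by_cases h1 : e1 = c1
  · right
    refine ⟨i, hi, i₀, hi₀, mem_rogersSimplex_of_eq T⁻¹ 0 0 hα0 le_rfl le_rfl (by linarith) ?_⟩
    simp only [Matrix.cons_val_zero, zero_smul, add_zero]
    rw [← hc1def, ← h1, ← hxe1]; abel
  -- second exit: from `c1` through `e1`
  obtain ⟨T₂, hT₂1, he2, -, j, hj, hj0, hjneg⟩ := ray_exit_through hV hsat hc1.1 he1 h1
  obtain ⟨hjV, -, hjv⟩ := (mem_nearSet hV).1 hj
  set e2 := c1 + T₂ • (e1 - c1) with he2def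
  have hT₂ : 0 < T₂ := by linarith
  have he1e2 : e1 - c1 = T₂⁻¹ • (e2 - c1) := by
    rw [he2def, add_sub_cancel_left, smul_smul, inv_mul_cancel₀ hT₂.ne', one_smul]
  have he2i : e2 ∈ bis v i := add_smul_sub_mem_bis hc1.2 hi0 T₂
  have he2F : e2 ∈ face2 V v i j := ⟨⟨he2, he2i⟩, hj0⟩
  have hne2 : (face2 V v i j).Nonempty := ⟨e2, he2F⟩
  have hc2 := cpt2_mem hne2
  set c2 := cpt2 V v i j with hc2def
  have hij : i ≠ j := by
    rintro rfl; rw [hc1.2] at hjneg; exact lt_irrefl _ hjneg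
  have hβ0 : 0 ≤ T₂⁻¹ := by positivity
  have hβ1 : T₂⁻¹ ≤ 1 := inv_le_one_of_one_le₀ hT₂1
  by_cases h2 : e2 = c2
  · right
    refine ⟨i, hi, j, hj, mem_rogersSimplex_of_eq (T⁻¹ * (1 - T₂⁻¹)) (T⁻¹ * T₂⁻¹) 0
      (mul_nonneg hα0 (by linarith)) (mul_nonneg hα0 hβ0) le_rfl (by nlinarith) ?_⟩
    simp only [Matrix.cons_val_zero, Matrix.cons_val_one, zero_smul, add_zero]
    rw [← hc1def, ← hc2def, ← h2]
    have : x = v + T⁻¹ • (e1 - v) := by rw [← hxe1]; abel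
    rw [this, show e1 - v = (c1 - v) + T₂⁻¹ • (e2 - c1) by rw [← he1e2]; abel]
    module
  -- third exit: from `c2` through `e2`
  obtain ⟨T₃, hT₃1, he3, -, k, hk, hk0, hkneg⟩ := ray_exit_through hV hsat hc2.1.1 he2 h2
  set e3 := c2 + T₃ • (e2 - c2) with he3def
  have hT₃ : 0 < T₃ := by linarith
  have he2e3 : e2 - c2 = T₃⁻¹ • (e3 - c2) := by
    rw [he3def, add_sub_cancel_left, smul_smul, inv_mul_cancel₀ hT₃.ne', one_smul]
  have he3i : e3 ∈ bis v i := add_smul_sub_mem_bis hc2.1.2 he2i T₃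
  have he3j : e3 ∈ bis v j := add_smul_sub_mem_bis hc2.2 hj0 T₃
  have he3F : e3 ∈ face3 V v i j k := ⟨⟨⟨he3, he3i⟩, he3j⟩, hk0⟩
  have hne3 : (face3 V v i j k).Nonempty := ⟨e3, he3F⟩
  have hik : i ≠ k := by
    rintro rfl; rw [hc2.1.2] at hkneg; exact lt_irrefl _ hkneg
  have hjk : j ≠ k := by
    rintro rfl; rw [hc2.2] at hkneg; exact lt_irrefl _ hkneg
  have hce : c2 ≠ e3 := by
    intro h
    apply h2
    have : T₃ • (e2 - c2) = 0 := by
      have := congrArg (fun p => p - c2) h; simpa [he3def] using this.symm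
    rcases smul_eq_zero.1 this with h' | h'
    · exact absurd h' hT₃.ne'
    · exact (sub_eq_zero.1 h')
  have hsub := face3_subset_singleton (V := V) hiv hjv hij hc2.1.2 hc2.2 he3i he3j hce hkneg hk0
  have hc3 : cpt3 V v i j k = e3 := mem_singleton_iff.1 (hsub (cpt3_mem hne3))
  have hγ0 : 0 ≤ T₃⁻¹ := by positivity
  have hγ1 : T₃⁻¹ ≤ 1 := inv_le_one_of_one_le₀ hT₃1
  left
  refine ⟨i, hi, j, hj, k, hk, hij, hik, hjk, hne3,
    mem_rogersSimplex_of_eq (T⁻¹ * (1 - T₂⁻¹)) (T⁻¹ * T₂⁻¹ * (1 - T₃⁻¹)) (T⁻¹ * T₂⁻¹ * T₃⁻¹)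
      (mul_nonneg hα0 (by linarith)) (mul_nonneg (mul_nonneg hα0 hβ0) (by linarith))
      (mul_nonneg (mul_nonneg hα0 hβ0) hγ0) (by nlinarith [mul_nonneg hα0 hβ0]) ?_⟩
  simp only [pieceVec, Matrix.cons_val_zero, Matrix.cons_val_one, Matrix.cons_val_two,
    Matrix.head_cons, Matrix.tail_cons]
  rw [← hc1def, ← hc2def, hc3]
  have : x = v + T⁻¹ • (e1 - v) := by rw [← hxe1]; abel
  rw [this, show e1 - v = (c1 - v) + T₂⁻¹ • (e2 - c1) by rw [← he1e2]; abel,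
    show e2 - c1 = (c2 - v) - (c1 - v) + T₃⁻¹ • (e3 - c2) by rw [← he2e3]; abel]
  module


/-! ### B10. Degenerate simplices are null -/

/-- If `L_c` kills a non-zero vector, `det L_c = 0`. [folklore] -/
theorem det_edgeMap_eq_zero_of_apply {c : Fin 3 → E3} {t : E3} (ht : t ≠ 0)
    (h : edgeMap c t = 0) : LinearMap.det (edgeMap c) = 0 := by
  rw [det_edgeMap, ← Matrix.exists_mulVec_eq_zero_iff]
  refine ⟨WithLp.ofLp t, fun h0 => ht ?_, ?_⟩
  · have := congrArg (WithLp.toLp 2) h0; simpa using this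
  · ext a
    have := congrArg (fun p : E3 => p a) h
    simp only [edgeMap_apply, WithLp.ofLp_sum, WithLp.ofLp_smul, Finset.sum_apply,
      Pi.smul_apply, smul_eq_mul, WithLp.ofLp_zero, Pi.zero_apply] at this
    simp only [Matrix.mulVec, dotProduct, Matrix.of_apply, Pi.zero_apply]
    rw [← this]
    exact Finset.sum_congr rfl fun x _ => mul_comm _ _

/-- Parallel second and third edges (relative to the first vertex) make the simplex degenerate:
`det L_c = 0` if `c₂ = c₁ + r d`, `c₃ = c₁ + r' d`. [folklore] -/
theorem det_edgeMap_eq_zero_of_parallel {c : Fin 3 → E3} {d : E3} {r r' : ℝ}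
    (h1 : c 1 = c 0 + r • d) (h2 : c 2 = c 0 + r' • d) : LinearMap.det (edgeMap c) = 0 := by
  by_cases hr : r = 0
  · refine det_edgeMap_eq_zero_of_apply (t := !₂[1, -1, 0]) (by simp) ?_
    rw [edgeMap_apply]; simp [Fin.sum_univ_three, h1, hr]
  · refine det_edgeMap_eq_zero_of_apply (t := !₂[r' - r, -r', r]) ?_ ?_
    · intro h0
      have := congrArg (fun t : E3 => t 2) h0
      simp at this; exact hr this
    · rw [edgeMap_apply]; simp [Fin.sum_univ_three, h1, h2]; module

/-- A degenerate simplex is a null set. [folklore] -/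
theorem volume_rogersSimplex_eq_zero {v : E3} {c : Fin 3 → E3}
    (h : LinearMap.det (edgeMap c) = 0) : volume (rogersSimplex v c) = 0 := by
  rw [volume_rogersSimplex_eq_det, h]; simp

/-- The planar triangle `conv{v, a, b}` (a simplex with zero third edge) is null. [folklore] -/
theorem volume_triangle_eq_zero (v a b : E3) : volume (rogersSimplex v ![a, b, 0]) = 0 :=
  volume_rogersSimplex_eq_zero (det_edgeMap_eq_zero_of_apply (t := !₂[0, 0, 1]) (by simp)
    (by rw [edgeMap_apply]; simp [Fin.sum_univ_three]))

/-! ### B11. Disjointness of the pieces up to null sets -/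

/-- Barycentric normal form of a point of a simplex other than the apex:
`p = lineMap v (lineMap a (lineMap b c τ) σ) s` with `s ∈ (0, 1]`, `σ, τ ∈ [0, 1]`. [folklore] -/
theorem exists_lineMap_of_mem_rogersSimplex {v a b c p : E3}
    (hp : p ∈ rogersSimplex v ![a - v, b - v, c - v]) (hpv : p ≠ v) :
    ∃ s σ τ : ℝ, 0 < s ∧ s ≤ 1 ∧ σ ∈ Icc (0 : ℝ) 1 ∧ τ ∈ Icc (0 : ℝ) 1 ∧
      p = AffineMap.lineMap v (AffineMap.lineMap a (AffineMap.lineMap b c τ) σ) s := by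
  obtain ⟨t, ⟨ht0, ht1⟩, rfl⟩ := hp
  have h0 := ht0 0; have h1 := ht0 1; have h2 := ht0 2
  set s := t 0 + t 1 + t 2 with hs
  have hs1 : s ≤ 1 := by simpa [Fin.sum_univ_three] using ht1
  have hspos : 0 < s := by
    rcases (show 0 ≤ s by positivity).lt_or_eq with h | h
    · exact h
    · exfalso; apply hpv
      have e0 : t 0 = 0 := by linarith
      have e1 : t 1 = 0 := by linarith
      have e2 : t 2 = 0 := by linarith
      show v + edgeMap _ t = v
      rw [edgeMap_apply]; simp [Fin.sum_univ_three, e0, e1, e2]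
  have key : ∀ σ τ : ℝ, s * σ = t 1 + t 2 → (t 1 + t 2) * τ = t 2 →
      v + edgeMap ![a - v, b - v, c - v] t =
        AffineMap.lineMap v (AffineMap.lineMap a (AffineMap.lineMap b c τ) σ) s := by
    intro σ τ hσ hτ
    rw [edgeMap_apply]
    simp only [AffineMap.lineMap_apply_module', Fin.sum_univ_three, Matrix.cons_val_zero,
      Matrix.cons_val_one, Matrix.cons_val_two, Matrix.head_cons, Matrix.tail_cons]
    rw [show s • (σ • (τ • (c - b) + b - a) + a - v) + v =
        ((s * σ) * τ) • (c - b) + (s * σ) • (b - a) + s • (a - v) + v by module, hσ, hτ, hs]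
    module
  by_cases hστ : t 1 + t 2 = 0
  · -- `σ = 0`
    refine ⟨s, 0, 0, hspos, hs1, ⟨le_rfl, zero_le_one⟩, ⟨le_rfl, zero_le_one⟩, ?_⟩
    have e2 : t 2 = 0 := by linarith
    exact key 0 0 (by rw [hστ]; ring) (by rw [e2]; ring)
  · have hστpos : 0 < t 1 + t 2 := lt_of_le_of_ne (by positivity) (Ne.symm hστ)
    refine ⟨s, (t 1 + t 2) / s, t 2 / (t 1 + t 2), hspos, hs1,
      ⟨by positivity, by rw [div_le_one hspos]; linarith⟩,
      ⟨by positivity, by rw [div_le_one hστpos]; linarith⟩, ?_⟩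
    exact key _ _ (mul_div_cancel₀ _ hspos.ne') (mul_div_cancel₀ _ hστpos.ne')

/-- **Uniqueness along two tight directions.** If `lineMap q y s = lineMap q y' s'` with
`s, s' > 0`, where the constraint `a` is strictly slack at `q`, tight at `y`, satisfied at `y'`,
and the constraint `b` is strictly slack at `q`, tight at `y'`, satisfied at `y`, then `s = s'`
and `y = y'`. [cite: HalesDSP2012, Lemmas 5.58–5.59] -/
theorem lineMap_unique {v q y y' a b : E3} {s s' : ℝ} (hs : 0 < s) (hs' : 0 < s')
    (haq : slackFn v a q < 0) (hbq : slackFn v b q < 0) (hay : slackFn v a y = 0)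
    (hby' : slackFn v b y' = 0) (hay' : slackFn v a y' ≤ 0) (hby : slackFn v b y ≤ 0)
    (h : AffineMap.lineMap q y s = AffineMap.lineMap q y' s') : s = s' ∧ y = y' := by
  have ha := congrArg (slackFn v a) h
  have hb := congrArg (slackFn v b) h
  simp only [slackFn_lineMap, hay, hby', mul_zero, add_zero] at ha hb
  have h1 : s ≤ s' := by nlinarith
  have h2 : s' ≤ s := by nlinarith
  have hss : s = s' := le_antisymm h1 h2
  refine ⟨hss, ?_⟩
  rw [← hss, AffineMap.lineMap_apply_module', AffineMap.lineMap_apply_module', add_left_inj] at h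
  have := smul_right_injective E3 hs.ne' h
  simpa using this

/-- An edge piece lies on a bounded segment of its line. [folklore] -/
theorem face2_subset_lineMap {V : Set E3} (hV : IsUnitBallPacking V) (hsat : IsSaturated V)
    {v i j : E3} (hi : i ∈ nearSet V v) (hj : j ∈ nearSet V v) (hij : i ≠ j)
    (hne : (face2 V v i j).Nonempty) :
    ∃ lo hi : E3, ∀ w ∈ face2 V v i j, ∃ μ ∈ Icc (0 : ℝ) 1, w = AffineMap.lineMap lo hi μ := by
  obtain ⟨-, -, hiv⟩ := (mem_nearSet hV).1 hi
  obtain ⟨-, -, hjv⟩ := (mem_nearSet hV).1 hj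
  have hc := cpt2_mem hne
  set c := cpt2 V v i j
  set d := crossE (i - v) (j - v)
  have hd : d ≠ 0 := crossE_ne_zero_of_tight hiv hjv hij hc.1.2 hc.2
  have hdpos : 0 < ‖d‖ := norm_pos_iff.2 hd
  set R := 4 / ‖d‖ with hR
  have hRpos : 0 < R := by positivity
  refine ⟨c - R • d, c + R • d, fun w hw => ?_⟩
  obtain ⟨r, hr⟩ := exists_sub_eq_smul_of_mem_bis hiv hjv hij hw.1.2 hw.2 hc.1.2 hc.2
  have hwv : dist w v < 2 := mem_ball.1 (voronoiCell_subset_ball hsat v hw.1.1)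
  have hcv : dist c v < 2 := mem_ball.1 (voronoiCell_subset_ball hsat v hc.1.1)
  have hr4 : |r| * ‖d‖ < 4 := by
    rw [← Real.norm_eq_abs, ← norm_smul, ← hr]
    calc ‖w - c‖ = dist w c := (dist_eq_norm w c).symm
      _ ≤ dist w v + dist c v := dist_triangle_right w c v
      _ < 2 + 2 := add_lt_add hwv hcv
      _ = 4 := by norm_num
  have hrR : |r| < R := by rw [hR, lt_div_iff₀ hdpos]; exact hr4
  have hrR' := abs_lt.1 hrR
  refine ⟨(r + R) / (2 * R), ⟨?_, ?_⟩, ?_⟩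
  · apply div_nonneg <;> linarith
  · rw [div_le_one (by positivity)]; linarith
  · rw [AffineMap.lineMap_apply_module', show c + R • d - (c - R • d) = (2 * R) • d by module,
      smul_smul, div_mul_cancel₀ _ (by positivity), show w = c + r • d by rw [← hr]; abel]
    module


/-- A point of the cone over a segment lies in the planar triangle on it. [folklore] -/
theorem lineMap_lineMap_mem_triangle {v a b : E3} {σ s : ℝ} (hσ : σ ∈ Icc (0 : ℝ) 1) (hs0 : 0 ≤ s)
    (hs1 : s ≤ 1) :
    AffineMap.lineMap v (AffineMap.lineMap a b σ) s ∈ rogersSimplex v ![a - v, b - v, 0] :=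
  mem_rogersSimplex_of_eq (s * (1 - σ)) (s * σ) 0 (mul_nonneg hs0 (by linarith [hσ.2]))
    (mul_nonneg hs0 hσ.1) le_rfl (by nlinarith)
    (by simp only [AffineMap.lineMap_apply_module', Matrix.cons_val_zero, Matrix.cons_val_one,
          Matrix.cons_val_two, Matrix.head_cons, Matrix.tail_cons]; module)

/-- The vertices of the normal form lie in the faces. [folklore] -/
theorem lineMap_mem_face2 {V : Set E3} {v i j k : E3} (hne : (face3 V v i j k).Nonempty)
    {τ : ℝ} (hτ : τ ∈ Icc (0 : ℝ) 1) :
    AffineMap.lineMap (cpt2 V v i j) (cpt3 V v i j k) τ ∈ face2 V v i j :=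
  (convex_face2 i j).lineMap_mem (cpt2_mem (hne.mono (face3_subset_face2 i j k)))
    (face3_subset_face2 i j k (cpt3_mem hne)) hτ

/-- The vertices of the normal form lie in the faces (`F¹`). [folklore] -/
theorem lineMap_mem_face1 {V : Set E3} {v i j k : E3} (hne : (face3 V v i j k).Nonempty)
    {σ τ : ℝ} (hσ : σ ∈ Icc (0 : ℝ) 1) (hτ : τ ∈ Icc (0 : ℝ) 1) :
    AffineMap.lineMap (cpt1 V v i)
      (AffineMap.lineMap (cpt2 V v i j) (cpt3 V v i j k) τ) σ ∈ face1 V v i :=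
  (convex_face1 i).lineMap_mem
    (cpt1_mem ((hne.mono (face3_subset_face2 i j k)).mono (face2_subset_face1 i j)))
    (face2_subset_face1 i j (lineMap_mem_face2 hne hτ)) hσ

/-- Degenerate piece, first kind: `c₁(i)` tight for `j`. [folklore] -/
theorem volume_piece_eq_zero_of_cpt1_mem {V : Set E3} (hV : IsUnitBallPacking V) {v i j k : E3}
    (hi : i ∈ nearSet V v) (hj : j ∈ nearSet V v) (hij : i ≠ j)
    (hne : (face3 V v i j k).Nonempty) (h : cpt1 V v i ∈ bis v j) :
    volume (rogersSimplex v (pieceVec V v (i, j, k))) = 0 := by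
  obtain ⟨-, -, hiv⟩ := (mem_nearSet hV).1 hi
  obtain ⟨-, -, hjv⟩ := (mem_nearSet hV).1 hj
  have hne2 := hne.mono (face3_subset_face2 i j k)
  have h1 := cpt1_mem (hne2.mono (face2_subset_face1 i j))
  have h2 := cpt2_mem hne2
  have h3 := face3_subset_face2 i j k (cpt3_mem hne)
  obtain ⟨r, hr⟩ := exists_sub_eq_smul_of_mem_bis hiv hjv hij h2.1.2 h2.2 h1.2 h
  obtain ⟨r', hr'⟩ := exists_sub_eq_smul_of_mem_bis hiv hjv hij h3.1.2 h3.2 h1.2 h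
  refine volume_rogersSimplex_eq_zero (det_edgeMap_eq_zero_of_parallel (r := r) (r' := r')
    (d := crossE (i - v) (j - v)) ?_ ?_)
  · simp only [pieceVec, Matrix.cons_val_one, Matrix.cons_val_zero]
    rw [← hr]; abel
  · simp only [pieceVec, Matrix.cons_val_two, Matrix.tail_cons, Matrix.head_cons,
      Matrix.cons_val_zero]
    rw [← hr']; abel

/-- Degenerate piece, second kind: `c₂(i,j)` tight for `k` (then `c₃ = c₂`). [folklore] -/
theorem cpt3_eq_cpt2_of_mem {V : Set E3} {v i j k : E3} (hne : (face3 V v i j k).Nonempty)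
    (h : cpt2 V v i j ∈ bis v k) : cpt3 V v i j k = cpt2 V v i j := by
  have hne2 := hne.mono (face3_subset_face2 i j k)
  have h2 := cpt2_mem hne2
  exact nearestPt_eq_of_dist_le (isClosed_face3 i j k) (convex_face3 i j k) ⟨h2, h⟩ v
    fun x hx => dist_nearestPt_le (isClosed_face2 i j) (convex_face2 i j) hne2 v
      (face3_subset_face2 i j k hx)

/-- Degenerate piece, second kind, is null. [folklore] -/
theorem volume_piece_eq_zero_of_cpt2_mem {V : Set E3} {v i j k : E3}
    (hne : (face3 V v i j k).Nonempty) (h : cpt2 V v i j ∈ bis v k) :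
    volume (rogersSimplex v (pieceVec V v (i, j, k))) = 0 := by
  have h3 := cpt3_eq_cpt2_of_mem hne h
  refine volume_rogersSimplex_eq_zero (det_edgeMap_eq_zero_of_parallel (r := 1) (r' := 1)
    (d := cpt2 V v i j - cpt1 V v i) ?_ ?_)
  · simp only [pieceVec, Matrix.cons_val_one, Matrix.cons_val_zero]; module
  · simp only [pieceVec, Matrix.cons_val_two, Matrix.tail_cons, Matrix.head_cons,
      Matrix.cons_val_zero, h3]; module

/-- Strict slackness from non-tightness on the cell. [folklore] -/
theorem slackFn_neg_of_not_mem {V : Set E3} {v k p : E3} (hp : p ∈ voronoiCell V v) (hk : k ∈ V)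
    (h : p ∉ bis v k) : slackFn v k p < 0 :=
  lt_of_le_of_ne (slackFn_nonpos_of_mem hp hk) h


/-- **Disjointness, different first centres.**
[cite: HalesDSP2012, Lemma 6.29] [cite: Rogers1964, Ch. 7 §2] -/
theorem volume_inter_pieces_of_ne {V : Set E3} (hV : IsUnitBallPacking V) (hsat : IsSaturated V)
    {v i j k i' j' k' : E3} (hi : i ∈ nearSet V v) (hi' : i' ∈ nearSet V v) (hii' : i ≠ i')
    (hne : (face3 V v i j k).Nonempty) (hne' : (face3 V v i' j' k').Nonempty) :
    volume (rogersSimplex v (pieceVec V v (i, j, k)) ∩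
      rogersSimplex v (pieceVec V v (i', j', k'))) = 0 := by
  obtain ⟨hiV, -, hiv⟩ := (mem_nearSet hV).1 hi
  obtain ⟨hi'V, -, hi'v⟩ := (mem_nearSet hV).1 hi'
  -- a common point other than `v` lies on a ray from `v` through a point of `face2 i i'`
  have key : ∀ p, p ∈ rogersSimplex v (pieceVec V v (i, j, k)) →
      p ∈ rogersSimplex v (pieceVec V v (i', j', k')) → p ≠ v →
      ∃ y ∈ face2 V v i i', ∃ s : ℝ, 0 < s ∧ s ≤ 1 ∧ p = AffineMap.lineMap v y s := by
    intro p hp hp' hpv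
    obtain ⟨s, σ, τ, hs, hs1, hσ, hτ, hpe⟩ := exists_lineMap_of_mem_rogersSimplex hp hpv
    obtain ⟨s', σ', τ', hs', -, hσ', hτ', hpe'⟩ := exists_lineMap_of_mem_rogersSimplex hp' hpv
    have hy := lineMap_mem_face1 hne hσ hτ
    have hy' := lineMap_mem_face1 hne' hσ' hτ'
    obtain ⟨-, hyy'⟩ := lineMap_unique hs hs' (slackFn_self_lt v hiv) (slackFn_self_lt v hi'v)
      hy.2 hy'.2 (slackFn_nonpos_of_mem hy'.1 hiV) (slackFn_nonpos_of_mem hy.1 hi'V)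
      (hpe.symm.trans hpe')
    refine ⟨_, ⟨hy, ?_⟩, s, hs, hs1, hpe⟩
    rw [hyy']; exact hy'.2
  by_cases hF : (face2 V v i i').Nonempty
  · obtain ⟨lo, hi, hseg⟩ := face2_subset_lineMap hV hsat hi hi' hii' hF
    refine measure_mono_null (fun p ⟨hp, hp'⟩ => ?_) (volume_triangle_eq_zero v (lo - v) (hi - v))
    by_cases hpv : p = v
    · rw [hpv]
      exact mem_rogersSimplex_of_eq 0 0 0 le_rfl le_rfl le_rfl (by norm_num) (by simp)
    obtain ⟨y, hy, s, hs, hs1, rfl⟩ := key p hp hp' hpv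
    obtain ⟨μ, hμ, rfl⟩ := hseg y hy
    exact lineMap_lineMap_mem_triangle hμ hs.le hs1
  · refine measure_mono_null (fun p ⟨hp, hp'⟩ => ?_) (measure_singleton v)
    by_contra hpv
    obtain ⟨y, hy, -⟩ := key p hp hp' hpv
    exact hF ⟨y, hy⟩

/-- **Disjointness, equal first centres** (the in-facet analysis).
[cite: HalesDSP2012, Lemma 6.29] [cite: Rogers1964, Ch. 7 §2] -/
theorem volume_inter_pieces_of_eq {V : Set E3} (hV : IsUnitBallPacking V)
    {v i j k j' k' : E3} (hi : i ∈ nearSet V v) (hj : j ∈ nearSet V v) (hk : k ∈ nearSet V v)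
    (hj' : j' ∈ nearSet V v) (hk' : k' ∈ nearSet V v) (hij : i ≠ j) (hij' : i ≠ j')
    (hne : (face3 V v i j k).Nonempty) (hne' : (face3 V v i j' k').Nonempty)
    (hd1 : cpt1 V v i ∉ bis v j) (hd2 : cpt2 V v i j ∉ bis v k)
    (hd1' : cpt1 V v i ∉ bis v j') (hd2' : cpt2 V v i j' ∉ bis v k')
    (hvec : pieceVec V v (i, j, k) ≠ pieceVec V v (i, j', k')) :
    volume (rogersSimplex v (pieceVec V v (i, j, k)) ∩
      rogersSimplex v (pieceVec V v (i, j', k'))) = 0 := by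
  obtain ⟨hiV, -, hiv⟩ := (mem_nearSet hV).1 hi
  obtain ⟨hjV, -, hjv⟩ := (mem_nearSet hV).1 hj
  obtain ⟨hkV, -, hkv⟩ := (mem_nearSet hV).1 hk
  obtain ⟨hj'V, -, hj'v⟩ := (mem_nearSet hV).1 hj'
  obtain ⟨hk'V, -, hk'v⟩ := (mem_nearSet hV).1 hk'
  have hne2 := hne.mono (face3_subset_face2 i j k)
  have hne2' := hne'.mono (face3_subset_face2 i j' k')
  have hne1 := hne2.mono (face2_subset_face1 i j)
  have hc1 := cpt1_mem hne1
  have hc2 := cpt2_mem hne2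
  have hc2' := cpt2_mem hne2'
  have hc3 := cpt3_mem hne
  have hc3' := cpt3_mem hne'
  set c1 := cpt1 V v i with hc1def
  set c2 := cpt2 V v i j with hc2def
  set c3 := cpt3 V v i j k with hc3def
  set c2' := cpt2 V v i j' with hc2'def
  set c3' := cpt3 V v i j' k' with hc3'def
  -- the null set
  set S := rogersSimplex v ![c1 - v, c2 - v, 0] ∪
    rogersSimplex v ![c1 - v, cpt3 V v i j j' - v, 0] with hS
  have hS0 : volume S = 0 := measure_union_null (volume_triangle_eq_zero _ _ _)
    (volume_triangle_eq_zero _ _ _)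
  refine measure_mono_null (fun p ⟨hp, hp'⟩ => ?_) hS0
  have memT1 : ∀ {σ s : ℝ}, σ ∈ Icc (0:ℝ) 1 → 0 < s → s ≤ 1 →
      AffineMap.lineMap v (AffineMap.lineMap c1 c2 σ) s ∈ S := fun hσ hs hs1 =>
    Or.inl (lineMap_lineMap_mem_triangle hσ hs.le hs1)
  by_cases hpv : p = v
  · left; rw [hpv]
    exact mem_rogersSimplex_of_eq 0 0 0 le_rfl le_rfl le_rfl (by norm_num) (by simp)
  obtain ⟨s, σ, τ, hs, hs1, hσ, hτ, hpe⟩ := exists_lineMap_of_mem_rogersSimplex hp hpv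
  obtain ⟨s', σ', τ', hs', hs1', hσ', hτ', hpe'⟩ := exists_lineMap_of_mem_rogersSimplex hp' hpv
  have hy := lineMap_mem_face1 hne hσ hτ
  have hy' := lineMap_mem_face1 hne' hσ' hτ'
  obtain ⟨hss', hyy'⟩ := lineMap_unique hs hs' (slackFn_self_lt v hiv) (slackFn_self_lt v hiv)
    hy.2 hy'.2 (slackFn_nonpos_of_mem hy'.1 hiV) (slackFn_nonpos_of_mem hy.1 hiV)
    (hpe.symm.trans hpe')
  set z := AffineMap.lineMap c2 c3 τ with hzdef
  set z' := AffineMap.lineMap c2' c3' τ' with hz'def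
  have hz : z ∈ face2 V v i j := lineMap_mem_face2 hne hτ
  have hz' : z' ∈ face2 V v i j' := lineMap_mem_face2 hne' hτ'
  -- `σ = 0` or `σ' = 0`: the point is over `[v, c1]`
  rcases hσ.1.eq_or_lt with hσ0 | hσpos
  · rw [hpe, ← hσ0, AffineMap.lineMap_apply_zero]
    have := memT1 (σ := 0) ⟨le_rfl, zero_le_one⟩ hs hs1
    rwa [AffineMap.lineMap_apply_zero] at this
  rcases hσ'.1.eq_or_lt with hσ0' | hσpos'
  · rw [hpe, hyy', ← hσ0', AffineMap.lineMap_apply_zero]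
    have := memT1 (σ := 0) ⟨le_rfl, zero_le_one⟩ hs hs1
    rwa [AffineMap.lineMap_apply_zero] at this
  -- both positive: the in-facet uniqueness gives `σ = σ'`, `z = z'`
  obtain ⟨hσσ', hzz'⟩ := lineMap_unique hσpos hσpos' (slackFn_neg_of_not_mem hc1.1 hjV hd1)
    (slackFn_neg_of_not_mem hc1.1 hj'V hd1') hz.2 hz'.2 (slackFn_nonpos_of_mem hz'.1.1 hjV)
    (slackFn_nonpos_of_mem hz.1.1 hj'V) hyy'
  have hz3 : z ∈ face3 V v i j j' := ⟨hz, by rw [hzz']; exact hz'.2⟩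
  have hne3 : (face3 V v i j j').Nonempty := ⟨z, hz3⟩
  have hc'' := cpt3_mem hne3
  set c'' := cpt3 V v i j j' with hc''def
  by_cases hzc : z = c''
  · right
    rw [hpe, hzc]
    exact lineMap_lineMap_mem_triangle hσ hs.le hs1
  -- otherwise the two edge pieces coincide
  have hF : face2 V v i j = face2 V v i j' := by
    apply Set.Subset.antisymm
    · intro w hw
      obtain ⟨ρ, hρ⟩ := exists_eq_lineMap_of_mem_bis hiv hjv hij hw.1.2 hw.2 hz.1.2 hz.2
        hc''.1.1.2 hc''.1.2 hzc
      refine ⟨hw.1, ?_⟩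
      rw [mem_bis, hρ, slackFn_lineMap, show slackFn v j' z = 0 from hz3.2,
        show slackFn v j' c'' = 0 from hc''.2]; ring
    · intro w hw
      have hzi : z ∈ bis v i := hz.1.2
      have hzj' : z ∈ bis v j' := hz3.2
      obtain ⟨ρ, hρ⟩ := exists_eq_lineMap_of_mem_bis hiv hj'v hij' hw.1.2 hw.2 hzi hzj'
        hc''.1.1.2 hc''.2 hzc
      refine ⟨hw.1, ?_⟩
      rw [mem_bis, hρ, slackFn_lineMap, show slackFn v j z = 0 from hz.2,
        show slackFn v j c'' = 0 from hc''.1.2]; ring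
  have hc2eq : c2' = c2 := by rw [hc2'def, hc2def, cpt2, cpt2, hF]
  have hF3 : face3 V v i j' k' = face3 V v i j k' := by rw [face3, face3, hF]
  have hc3eq : c3' = cpt3 V v i j k' := by rw [hc3'def, cpt3, cpt3, hF3]
  have hneK : (face3 V v i j k').Nonempty := hF3 ▸ hne'
  have hck : c3 ≠ cpt3 V v i j k' := by
    intro h
    apply hvec
    show (![c1 - v, c2 - v, c3 - v] : Fin 3 → E3) = ![c1 - v, c2' - v, c3' - v]
    rw [hc2eq, hc3eq, h]
  -- `z ∈ [c2, c3] ∩ [c2, c3(i,j,k')]`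
  rcases hτ.1.eq_or_lt with hτ0 | hτpos
  · rw [hpe, hzdef, ← hτ0, AffineMap.lineMap_apply_zero]
    exact memT1 hσ hs hs1
  rcases hτ'.1.eq_or_lt with hτ0' | hτpos'
  · have : z = c2 := by rw [hzz', hz'def, ← hτ0', AffineMap.lineMap_apply_zero, hc2eq]
    rw [hpe, this]
    exact memT1 hσ hs hs1
  exfalso
  have hd2'' : slackFn v k' c2 < 0 := by
    rw [← hc2eq]; exact slackFn_neg_of_not_mem hc2'.1.1 hk'V hd2'
  have hcK := cpt3_mem hneK
  obtain ⟨-, h33⟩ := lineMap_unique hτpos hτpos' (slackFn_neg_of_not_mem hc2.1.1 hkV hd2) hd2''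
    hc3.2 hcK.2 (slackFn_nonpos_of_mem hcK.1.1.1 hkV) (slackFn_nonpos_of_mem hc3.1.1.1 hk'V)
    (by rw [← hzdef, hzz', hz'def, hc2eq, hc3eq])
  exact hck h33


/-- **Distinct pieces meet in a null set.**
[cite: HalesDSP2012, Lemma 6.29]
[cite: Rogers1964, Ch. 7 §2 ("fit together, without overlapping")] -/
theorem volume_inter_pieces {V : Set E3} (hV : IsUnitBallPacking V) (hsat : IsSaturated V)
    {v i j k i' j' k' : E3} (hi : i ∈ nearSet V v) (hj : j ∈ nearSet V v) (hk : k ∈ nearSet V v)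
    (hi' : i' ∈ nearSet V v) (hj' : j' ∈ nearSet V v) (hk' : k' ∈ nearSet V v) (hij : i ≠ j)
    (hij' : i' ≠ j') (hne : (face3 V v i j k).Nonempty) (hne' : (face3 V v i' j' k').Nonempty)
    (hvec : pieceVec V v (i, j, k) ≠ pieceVec V v (i', j', k')) :
    volume (rogersSimplex v (pieceVec V v (i, j, k)) ∩
      rogersSimplex v (pieceVec V v (i', j', k'))) = 0 := by
  -- degenerate pieces are null
  by_cases hd1 : cpt1 V v i ∈ bis v j
  · exact measure_mono_null inter_subset_left
      (volume_piece_eq_zero_of_cpt1_mem hV hi hj hij hne hd1)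
  by_cases hd2 : cpt2 V v i j ∈ bis v k
  · exact measure_mono_null inter_subset_left (volume_piece_eq_zero_of_cpt2_mem hne hd2)
  by_cases hd1' : cpt1 V v i' ∈ bis v j'
  · exact measure_mono_null inter_subset_right
      (volume_piece_eq_zero_of_cpt1_mem hV hi' hj' hij' hne' hd1')
  by_cases hd2' : cpt2 V v i' j' ∈ bis v k'
  · exact measure_mono_null inter_subset_right (volume_piece_eq_zero_of_cpt2_mem hne' hd2')
  by_cases hii' : i = i'
  · subst hii'
    exact volume_inter_pieces_of_eq hV hi hj hk hj' hk' hij hij' hne hne' hd1 hd2 hd1' hd2' hvec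
  · exact volume_inter_pieces_of_ne hV hsat hi hi' hii' hne hne'

/-! ### B12. The dissection -/

/-- **The dissection**: the finite family of Rogers simplices of the good triples witnesses
`Rogers1964_dissection`. [cite: Rogers1964, Ch. 7 §§2–3] [cite: HalesDSP2012, Lemmas 6.26, 6.29] -/
theorem dissection : Rogers1964_dissection := by
  intro V hV hsat v hv
  classical
  set N := nearSet V v with hN
  set G : Finset (E3 × E3 × E3) := (N ×ˢ (N ×ˢ N)).filter fun τ =>
    τ.1 ≠ τ.2.1 ∧ τ.1 ≠ τ.2.2 ∧ τ.2.1 ≠ τ.2.2 ∧ (face3 V v τ.1 τ.2.1 τ.2.2).Nonempty with hG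
  have hGmem : ∀ τ, τ ∈ G ↔ τ.1 ∈ N ∧ τ.2.1 ∈ N ∧ τ.2.2 ∈ N ∧ τ.1 ≠ τ.2.1 ∧ τ.1 ≠ τ.2.2 ∧
      τ.2.1 ≠ τ.2.2 ∧ (face3 V v τ.1 τ.2.1 τ.2.2).Nonempty := by
    intro τ; rw [hG, Finset.mem_filter, Finset.mem_product, Finset.mem_product]; tauto
  refine ⟨G.image (pieceVec V v), ?_, ?_, ?_⟩
  · intro c hc
    obtain ⟨⟨i, j, k⟩, hτ, rfl⟩ := Finset.mem_image.1 hc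
    obtain ⟨hi, hj, hk, hij, hik, hjk, hne⟩ := (hGmem _).1 hτ
    exact ⟨isRogersGram_pieceVec hV hv hi hj hk hij hik hjk hne, pieceVec_subset hV hv hne⟩
  · intro c hc c' hc' hcc'
    obtain ⟨⟨i, j, k⟩, hτ, rfl⟩ := Finset.mem_image.1 (Finset.mem_coe.1 hc)
    obtain ⟨⟨i', j', k'⟩, hτ', rfl⟩ := Finset.mem_image.1 (Finset.mem_coe.1 hc')
    obtain ⟨hi, hj, hk, hij, -, -, hne⟩ := (hGmem _).1 hτ
    obtain ⟨hi', hj', hk', hij', -, -, hne'⟩ := (hGmem _).1 hτ'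
    exact volume_inter_pieces hV hsat hi hj hk hi' hj' hk' hij hij' hne hne' hcc'
  · -- the uncovered part lies in finitely many planar triangles
    set Z := ⋃ i ∈ N, ⋃ j ∈ N, rogersSimplex v ![cpt1 V v i - v, cpt2 V v i j - v, 0] with hZ
    have hZ0 : volume Z = 0 := by
      rw [hZ]
      refine (measure_biUnion_null_iff N.countable_toSet).2 fun i _ => ?_
      refine (measure_biUnion_null_iff N.countable_toSet).2 fun j _ => ?_
      exact volume_triangle_eq_zero _ _ _
    refine measure_mono_null ?_ hZ0
    rintro x ⟨hx, hxU⟩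
    rcases cover hV hsat hv hx with ⟨i, hi, j, hj, k, hk, hij, hik, hjk, hne, hmem⟩ |
      ⟨i, hi, j, hj, hmem⟩
    · exfalso; apply hxU
      refine mem_iUnion₂.2 ⟨pieceVec V v (i, j, k), ?_, hmem⟩
      exact Finset.mem_image.2 ⟨(i, j, k), (hGmem _).2 ⟨hi, hj, hk, hij, hik, hjk, hne⟩, rfl⟩
    · rw [hZ]
      exact mem_iUnion₂.2 ⟨i, hi, mem_iUnion₂.2 ⟨j, hj, hmem⟩⟩


end RogersDissection

/-! ### B12'. The two discharges -/

/-- **DISCHARGE of the named fact `Rogers1964_dissection`** (Rogers's dissection of the Voronoi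
cell of a saturated packing into finitely many a.e.-disjoint simplices with his Gram conditions,
up to a null set). [cite: Rogers1964, Ch. 7 §§2–3] [cite: HalesDSP2012, Lemmas 6.26 and 6.29] -/
theorem Rogers1964_dissection_holds : Rogers1964_dissection :=
  RogersDissection.dissection

/-- **DISCHARGE of the named fact `Rogers1958_bound`** — Rogers's simplex bound: for every packing
of unit balls in `ℝ³` the upper density `limsup_{r → ∞} δ(V, 0, r)` is at most
`σ₃ = √2 (3 arccos (1/3) − π) = √18 (arccos (1/3) − π/3) ≈ 0.7797`.
[cite: Rogers1964, Ch. 7 §4, Theorem 7.1; Introduction §3] [cite: Rogers1958]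
[cite: HalesDSP2012, §6.2 (p. 150)] -/
theorem Rogers1958_bound_holds : Rogers1958_bound :=
  Rogers1958_bound_of_dissection Rogers1964_dissection_holds

/-- **DISCHARGE of the interface fact `Rogers1964_cellBound`** (Rogers's bound in Voronoi-cell
form: `vol B(v,1) ≤ σ₃ · vol Ω(V,v)` for every cell of a saturated packing), from the dissection
and the sector constant. [cite: Rogers1964, Ch. 7 §4 (proof of Theorem 7.1, (9)–(10))] -/
theorem Rogers1964_cellBound_holds : Rogers1964_cellBound :=
  cellBound_of_dissection Rogers1964_dissection_holds Rogers1964_orthoschemeSectorVolume_holds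

end Literature.Barriers.AtomisticToContinuum

end
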